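import Summits.BirchSwinnertonDyer.BirchSwinnertonDyer.Theses.KatoTransfer
import Literature.NumberTheory.EllipticCurves.KatoRankBoundLevelZeroProofs
import Literature.NumberTheory.EllipticCurves.PAdicGrossZagier
import Literature.NumberTheory.EllipticCurves.CanonicalPAdicHeightHolds
import Literature.NumberTheory.EllipticCurves.SupersingularDensityProofs
import Literature.NumberTheory.EllipticCurves.BertrandCMHeightNonvanishing

/-!
# Line `birth` (BC3 skeleton) for crux `KatoTransfer.PadicOrderLeAnalyticRankAtOnePrime`
# (stmt-BirchSwinnertonDyer-18413, route `route-BirchSwinnertonDyer-KatoTransfer`, crux rank 4)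

Registered by the skeleton registrar `planner-skel-stmt-BirchSwinnertonDyer-18413-0` (2026-08-17).

## The crux (recall)

`PadicOrderLeAnalyticRankAtOnePrime` (X3 of the route) = for every elliptic `E/ℚ` (globally minimal
`W`) there are ONE prime `p ≥ 5` of good ORDINARY reduction and a newform `f` attached to `W` (any
level) with `ord_{T=0} L_p(f, α_p; T) ≤ ord_{s=1} L(E, s)`, where `α_p = unitRoot W p` and
`L_p(f, α_p; T) = padicLFunction f α_p` is the slope-zero cyclotomic `p`-adic `L`-function. With X1
(`Ш[p^∞]` finite at one good prime) and X2 (Kato's `r_an ≤ corank Sel` at one prime) it closes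
`BirchSwinnertonDyer` (route file, `closes`).

## The cut: the three analytic-rank regimes, with the LEVERS named (not the bare trichotomy)

The gen-0 typing seat's registered sketch was the bare split `stub_rankZero / stub_rankOne /
stub_rankGeTwo`. Here the rank-`0` regime is NOT a stub: it is a five-line consequence of modularity
already in the tree (`order_padicLFunction_eq_zero_iff_analyticRank_eq_zero`: the interpolation
`L_p(0) = (1 - α⁻¹)² L(E,1)/Ω⁺` with `1 - α⁻¹ ≠ 0` at a good ordinary prime, plus
`infinite_goodOrdinaryPrimes_holds` for the prime), and the rank-`1` regime is cut into its KNOWN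
engine (Perrin-Riou's `p`-adic Gross–Zagier leading-term formulae) and its OPEN kernel (the canonical
`p`-adic height of a non-torsion point is non-zero at ONE good ordinary prime). Four named stubs:

* **M · `stub_modularity`** (KNOWN — Wiles, Taylor–Wiles, Breuil–Conrad–Diamond–Taylor 2001 Thm. A;
  size XL to formalise): every elliptic `W/ℚ` has a newform `f ∈ S_2(Γ₀(N))` (some level `N`) with
  `L(f,s) = L(W,s)`. Implied by the tree's undischarged named fact
  `Literature.NumberTheory.EllipticCurves.ModularForms.exists_isNewformOf` (level `N_W`), see
  `stub_modularity_of_exists_isNewformOf` below (sorry-free). The crux quantifies `∃ f` itself, so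
  this debt is the crux's own, not an artefact of the cut.
* **PR · `stub_perrinRiouLeadingTerms`** (KNOWN — Perrin-Riou 1987, Thm. 1.3 with §1.4 Cor. 1.8;
  Büyükboduk–Pollack–Sasaki 2018, Cor. 1.1.2 / Rem. 1.1.3; size XL): VERBATIM the tree's undischarged
  named fact `Literature.NumberTheory.EllipticCurves.perrinRiou_rankOne_leadingTerms`
  (`stub_perrinRiouLeadingTerms_iff : _ ↔ _ := Iff.rfl`): for `r_an(E) = 1`, `p ≥ 5` good ordinary,
  `D` the canonical `p`-adic height and `f` a newform of `W` there are a non-torsion `P ∈ E(ℚ)` and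
  `c ∈ ℚ` with `L'(E,1) = c · Ω⁺_f · ĥ(P)` and `[T¹] L_p(f,α;T) · log_p γ = c · (1 - α⁻¹)² · ⟨P,P⟩_D`.
* **H · `stub_padicHeightNeZeroAtOnePrime`** (OPEN — Schneider's non-degeneracy conjecture at ONE
  prime, for analytic-rank-one curves; research): if `r_an(E) = 1` there is a good ordinary `p ≥ 5`
  at which `⟨P,P⟩_D ≠ 0` for the canonical `D` and EVERY non-torsion `P ∈ E(ℚ)` (in Mordell–Weil
  rank one — Gross–Zagier–Kolyvagin — all such `P` are commensurable, so this is `Reg_p(E) ≠ 0`).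
  Known for CM curves at EVERY good ordinary `p ≥ 5` (Bertrand 1984, tree fact
  `bertrand_pairing_self_ne_zero_of_hasCM`; see `stub_padicHeight_of_hasCM` below, sorry-free);
  verified curve by curve numerically (Mazur–Stein–Tate 2006 §1, Stein–Wuthrich 2013); open in
  general (Mazur–Stein–Tate 2006, Conj. 1.1). Why it might fail: a rank-one non-CM curve whose
  generator has canonical `p`-adic height `0` at every good ordinary `p ≥ 5` is excluded by nothing
  proved (a `p`-adic Schanuel-type statement).
* **R2 · `stub_twoLeAnalyticRank`** (THE OPEN HEART; research): the crux for curves with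
  `ord_{s=1} L(E,s) ≥ 2` — at ONE good ordinary `p ≥ 5`, `ord_T L_p ≤ r_an`. Here `1 ≤ ord_T L_p` is
  known (`one_le_order_padicLFunction_iff`) and nothing bounds `ord_T L_p` from above in print (it is
  the "easy" inequality of `p`-adic BSD only granting non-degeneracy of the `p`-adic height AND the
  full leading-term formula, both open in rank `≥ 2`). Left whole: the route header files this regime
  as NOT DECOMPOSED YET, and any further cut today would be shredding.

`PadicOrderLeAnalyticRankAtOnePrime_of` is sorry-free: trichotomy `r_an = 0 ∨ r_an = 1 ∨ 2 ≤ r_an`;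
`r_an = 0`: a good ordinary `p ≥ 5` (`infinite_goodOrdinaryPrimes_holds`), `f` from M, and
`ord_T L_p = 0` by `order_padicLFunction_eq_zero_iff_analyticRank_eq_zero`; `r_an = 1`: `p` and the
height non-vanishing from H, `f` from M, the canonical `D` from `exists_isCanonical_holds`, `(P, c)`
from PR; `L'(E,1) ≠ 0` (`leadingLCoeff_ne_zero_holds` at `r_an = 1`) forces `c ≠ 0`, `1 - α⁻¹ ≠ 0`
(`one_sub_unitRoot_inv_ne_zero`) and `⟨P,P⟩_D ≠ 0` (H) make the right-hand side of the `p`-adic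
formula non-zero, so `[T¹] L_p ≠ 0` and `ord_T L_p ≤ 1` (`PowerSeries.order_le`); `2 ≤ r_an`: R2.

Honest sizes: M known (XL), PR known (XL), H open (believed; CM known), R2 open (the heart).

Barriers (route header): `PAdicHeightBarrier` (Literature/Barriers/BirchSwinnertonDyer/PAdicHeightNondegeneracy)
says that at a FIXED ordinary `p`, in analytic rank one, "`p`-adic order = complex order" is EQUIVALENT
to `⟨P,P⟩_p ≠ 0`; stub H is exactly that height statement but with `∃ p` (the route's evasion: one
prime suffices for `closes`), and its CM case is discharged by Bertrand (the barrier's own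
`evasions_known`). `SelmerRankBarrier`, `TwoDescentDefectUnbounded`, `NumericalVanishingBarrier`: not met
(no Selmer bound, no descent, exact order of vanishing `W.analyticRank`).

Disproof used: no `Disproof.lean` exists for this crux (`ledger crux ls`: no workfiles before this one),
so there is no `_false_without_` obstruction to honour and no landed Negative lemma under
`Theorems/PadicOrderLeAnalyticRankAtOnePrime/Negative/`. Negatives index of the summit: its refuted
statement(s) concern the existence of an admissible prime with `E[p]` irreducible / tame conditions for
CM curves (LeadingTerm `TamePinch`); no stub here asks for `E[p]` irreducible — H and R2 ask only for a
good ORDINARY `p ≥ 5`, which every `E/ℚ` has (`infinite_goodOrdinaryPrimes_holds`, CM included).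

BC3 probes (planner folder `bc/probe*.lean`, 2026-08-17): for each stub `S ∈ {M, PR, H, R2}`, both
`S → PadicOrderLeAnalyticRankAtOnePrime` and `S → BirchSwinnertonDyer` by
`first | exact? | simpa | aesop` FAIL (see the line card `Lines/birth.md` for the verbatim outcomes).
-/

set_option linter.unusedVariables false
set_option linter.dupNamespace false

noncomputable section

namespace Summit.BirchSwinnertonDyer.BirchSwinnertonDyer.Cruxes.PadicOrderLeAnalyticRankAtOnePrime.Birth

open scoped MatrixGroups ModularForm
open CongruenceSubgroup
open Summit.BirchSwinnertonDyer.BirchSwinnertonDyer.Theses.KatoTransfer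
open Literature
open Literature.NumberTheory.EllipticCurves
open Literature.NumberTheory.EllipticCurves.ModularForms

/-! ## The crux's conclusion at a curve, cut verbatim -/

/-- `Conclusion W`: the matrix of the crux at the curve `W` (verbatim): ONE good ordinary prime
`p ≥ 5` and a newform `f` of `W` with `ord_{T=0} L_p(f, α_p; T) ≤ ord_{s=1} L(W, s)`. -/
def Conclusion (W : WeierstrassCurve ℚ) [W.IsElliptic] [W.IsGloballyMinimal] : Prop :=
  ∃ (p : ℕ) (_ : Fact p.Prime), 5 ≤ p ∧ W.HasGoodReductionAtPrime p ∧ ¬ (p : ℤ) ∣ W.frobeniusTrace p ∧ ∃ (N : ℕ) (_ : NeZero N) (f : CuspForm (CongruenceSubgroup.Gamma0 N) 2), Literature.NumberTheory.EllipticCurves.ModularForms.IsNewformOf W f ∧ (Literature.NumberTheory.EllipticCurves.padicLFunction f (Literature.NumberTheory.EllipticCurves.unitRoot W p : ℚ_[p])).order ≤ (W.analyticRank : ℕ∞)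

/-- Sanity (definitional): the crux is `∀ W, Conclusion W` on the nose. -/
theorem padicOrderLeAnalyticRankAtOnePrime_iff :
    PadicOrderLeAnalyticRankAtOnePrime ↔
      ∀ (W : WeierstrassCurve ℚ) [W.IsElliptic] [W.IsGloballyMinimal], Conclusion W :=
  Iff.rfl

/-! ## Registered stubs -/

/-- **M · `stub_modularity` — every elliptic curve over `ℚ` is modular (KNOWN; XL to formalise).**
For `W/ℚ` elliptic (globally minimal) there is a cusp form `f ∈ S_2(Γ₀(N))`, some level `N ≥ 1`,
which is a normalised newform with `L(f,s) = L(W,s)` (`IsNewformOf W f`). Wiles 1995 / Taylor–Wiles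
1995 (semistable), Breuil–Conrad–Diamond–Taylor 2001, Thm. A (all `E/ℚ`), level `N_E` by Carayol.
Implied by the tree's named fact `ModularForms.exists_isNewformOf`
(`stub_modularity_of_exists_isNewformOf`). [cite: BreuilConradDiamondTaylor2001, Thm. A]
[cite: DiamondShurman2005, Thm. 8.8.3] -/
theorem stub_modularity :
    ∀ (W : WeierstrassCurve ℚ) [W.IsElliptic] [W.IsGloballyMinimal],
      ∃ (N : ℕ) (_ : NeZero N) (f : CuspForm (CongruenceSubgroup.Gamma0 N) 2), IsNewformOf W f := by
  sorry

/-- **PR · `stub_perrinRiouLeadingTerms` — Perrin-Riou's rank-one leading terms (KNOWN; XL).**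
VERBATIM the tree's named fact `perrinRiou_rankOne_leadingTerms`: for `W/ℚ` with
`ord_{s=1} L(W,s) = 1`, a good ordinary `p ≥ 5`, the canonical `p`-adic height `D` and a newform `f`
of `W`, there are a non-torsion `P ∈ W(ℚ)` and `c ∈ ℚ` with `L'(W,1) = c · Ω⁺_f · ĥ(P)` (Gross–Zagier,
Shimura rationality) and `[T¹] L_p(f,α;T) · log_p(γ) = c · (1 - α⁻¹)² · ⟨P,P⟩_D` (the `p`-adic
Gross–Zagier formula descended to `ℚ`). [cite: PerrinRiou1987, Thm. 1.3, (1.1) and §1.4 Cor. 1.8]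
[cite: BuyukbodukPollackSasaki2018, Cor. 1.1.2 and Rem. 1.1.3] [cite: GrossZagier1986, Thm. I.6.3] -/
theorem stub_perrinRiouLeadingTerms :
    ∀ (W : WeierstrassCurve ℚ) [W.IsElliptic] [W.IsGloballyMinimal] (p : ℕ) [Fact p.Prime],
      5 ≤ p → IsOrdinaryAt W p → W.analyticRank = 1 →
      ∀ (D : WeierstrassCurve.PAdicHeightData W p), D.IsCanonical →
      ∀ ⦃N : ℕ⦄ [NeZero N] (f : CuspForm (Gamma0 N) 2), IsNewformOf W f →
      ∃ (P : W.toAffine.Point) (c : ℚ), ¬ IsOfFinAddOrder P ∧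
        deriv W.entireLFunction 1 = (((c : ℝ) * plusPeriod f * P.canonicalHeight : ℝ) : ℂ) ∧
        PowerSeries.coeff 1 (padicLFunction f (unitRoot W p : ℚ_[p])) *
            padicLog p (cyclotomicGenerator p) =
          (c : ℚ_[p]) * (1 - (unitRoot W p : ℚ_[p])⁻¹) ^ 2 * D.pairing P P := by
  sorry

/-- **H · `stub_padicHeightNeZeroAtOnePrime` — Schneider's conjecture at ONE prime for curves of
analytic rank one (OPEN; CM case KNOWN).** If `ord_{s=1} L(W,s) = 1` then at SOME good ordinary prime
`p ≥ 5` the canonical cyclotomic `p`-adic height of every non-torsion `P ∈ W(ℚ)` is non-zero: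
`⟨P,P⟩_D ≠ 0` for the canonical `D` (in Mordell–Weil rank one this is `Reg_p(W) ≠ 0`). CM curves:
Bertrand 1984 at EVERY such `p` (`stub_padicHeight_of_hasCM`); numerically verified curve by curve
(Mazur–Stein–Tate 2006 §1; Stein–Wuthrich 2013 §4); open in general (Mazur–Stein–Tate 2006,
Conj. 1.1: non-degeneracy at every `p`). Why it might fail: a rank-one non-CM curve whose generator has
`p`-adic height `0` at every good ordinary `p ≥ 5` is excluded by nothing proved.
[cite: MazurSteinTate2006, Conj. 1.1 and §1] [cite: Bertrand1984ThetaCM, §3 Corollaire 1]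
[cite: SteinWuthrich2013, §4.1] -/
theorem stub_padicHeightNeZeroAtOnePrime :
    ∀ (W : WeierstrassCurve ℚ) [W.IsElliptic] [W.IsGloballyMinimal], W.analyticRank = 1 →
      ∃ (p : ℕ) (_ : Fact p.Prime), 5 ≤ p ∧ W.HasGoodReductionAtPrime p ∧
        ¬ (p : ℤ) ∣ W.frobeniusTrace p ∧
        ∀ (D : WeierstrassCurve.PAdicHeightData W p), D.IsCanonical →
          ∀ (P : W.toAffine.Point), ¬ IsOfFinAddOrder P → D.pairing P P ≠ 0 := by
  sorry

/-- **R2 · `stub_twoLeAnalyticRank` — the crux in analytic rank `≥ 2` (THE OPEN HEART).** For `W/ℚ`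
with `ord_{s=1} L(W,s) ≥ 2` there are ONE good ordinary `p ≥ 5` and a newform `f` of `W` with
`ord_{T=0} L_p(f, α_p; T) ≤ ord_{s=1} L(W,s)`. Conjecturally `ord_T L_p = r_an` at every good
ordinary `p` (`p`-adic BSD, Mazur–Tate–Teitelbaum 1986 §II.10; Bernardi–Perrin-Riou 1993), and only
`1 ≤ ord_T L_p` is known here (`one_le_order_padicLFunction_iff`). Why it might fail: a curve with
`T^{r_an+1} ∣ L_p(E,T)` at every good ordinary `p` contradicts `p`-adic BSD at every `p` at once
(extra zeros of `L_p` at `T = 0` for non-exceptional `p` are excluded by nothing proved).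
[cite: MazurTateTeitelbaum1986Invent, §II.10] [cite: Kato2004Asterisque, Thm. 18.4 (p. 281)]
[cite: SteinWuthrich2013, §4.1] -/
theorem stub_twoLeAnalyticRank :
    ∀ (W : WeierstrassCurve ℚ) [W.IsElliptic] [W.IsGloballyMinimal], 2 ≤ W.analyticRank →
      ∃ (p : ℕ) (_ : Fact p.Prime), 5 ≤ p ∧ W.HasGoodReductionAtPrime p ∧
        ¬ (p : ℤ) ∣ W.frobeniusTrace p ∧
        ∃ (N : ℕ) (_ : NeZero N) (f : CuspForm (CongruenceSubgroup.Gamma0 N) 2), IsNewformOf W f ∧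
          (padicLFunction f (unitRoot W p : ℚ_[p])).order ≤ (W.analyticRank : ℕ∞) := by
  sorry

/-! ## Stub statements by name -/

namespace Statement

/-- Statement of `stub_modularity`. -/
abbrev stub_modularity : Prop := type_of% @Birth.stub_modularity
/-- Statement of `stub_perrinRiouLeadingTerms`. -/
abbrev stub_perrinRiouLeadingTerms : Prop := type_of% @Birth.stub_perrinRiouLeadingTerms
/-- Statement of `stub_padicHeightNeZeroAtOnePrime`. -/
abbrev stub_padicHeightNeZeroAtOnePrime : Prop := type_of% @Birth.stub_padicHeightNeZeroAtOnePrime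
/-- Statement of `stub_twoLeAnalyticRank`. -/
abbrev stub_twoLeAnalyticRank : Prop := type_of% @Birth.stub_twoLeAnalyticRank

end Statement

/-! ## Where the known stubs sit in the tree (sorry-free remarks) -/

/-- M is implied by the tree's named modularity fact `exists_isNewformOf` (level `N_W ≥ 1` by
`conductorNorm_pos_holds`). -/
theorem stub_modularity_of_exists_isNewformOf (h : exists_isNewformOf) : Statement.stub_modularity := by
  intro W _ _
  haveI : NeZero (W.conductorNorm ℤ) := ⟨(W.conductorNorm_pos_holds).ne'⟩
  obtain ⟨f, hf⟩ := h W
  exact ⟨W.conductorNorm ℤ, inferInstance, f, hf⟩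

/-- PR is verbatim the tree's named fact `perrinRiou_rankOne_leadingTerms`. -/
theorem stub_perrinRiouLeadingTerms_iff :
    Statement.stub_perrinRiouLeadingTerms ↔ perrinRiou_rankOne_leadingTerms :=
  Iff.rfl

/-- The CM case of H, at EVERY curve with CM (no rank hypothesis), is Bertrand's theorem (tree named
fact `bertrand_pairing_self_ne_zero_of_hasCM`) at any good ordinary prime `p ≥ 5`, which exists by
`infinite_goodOrdinaryPrimes_holds` (Deuring: density `1/2` for CM curves). -/
theorem stub_padicHeight_of_hasCM (hBer : bertrand_pairing_self_ne_zero_of_hasCM)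
    (W : WeierstrassCurve ℚ) [W.IsElliptic] [W.IsGloballyMinimal] (hCM : W.HasCM) :
    ∃ (p : ℕ) (_ : Fact p.Prime), 5 ≤ p ∧ W.HasGoodReductionAtPrime p ∧
      ¬ (p : ℤ) ∣ W.frobeniusTrace p ∧
      ∀ (D : WeierstrassCurve.PAdicHeightData W p), D.IsCanonical →
        ∀ (P : W.toAffine.Point), ¬ IsOfFinAddOrder P → D.pairing P P ≠ 0 := by
  obtain ⟨p, ⟨hp, hgood, hord⟩, h4⟩ := (WeierstrassCurve.infinite_goodOrdinaryPrimes_holds W).exists_gt 4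
  exact ⟨p, hp, h4, hgood, hord, hBer W hCM p h4 hgood hord⟩

/-! ## The composition (sorry-free) -/

/-- **Analytic rank `0`** needs only M: at any good ordinary `p ≥ 5` (there are infinitely many),
`ord_T L_p(f,α;T) = 0 ↔ r_an = 0` (`order_padicLFunction_eq_zero_iff_analyticRank_eq_zero`: the
interpolation formula at the trivial character with `1 - α⁻¹ ≠ 0`). -/
theorem conclusion_of_analyticRank_eq_zero (hM : Statement.stub_modularity) (W : WeierstrassCurve ℚ)
    [W.IsElliptic] [W.IsGloballyMinimal] (h0 : W.analyticRank = 0) : Conclusion W := by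
  obtain ⟨p, ⟨hp, hgood, hord⟩, h4⟩ := (WeierstrassCurve.infinite_goodOrdinaryPrimes_holds W).exists_gt 4
  obtain ⟨N, hN, f, hf⟩ := hM W
  refine ⟨p, hp, h4, hgood, hord, N, hN, f, hf, ?_⟩
  rw [(order_padicLFunction_eq_zero_iff_analyticRank_eq_zero W p ⟨hgood, hord⟩ hf).mpr h0]
  exact zero_le

/-- **Analytic rank `1`** from M, PR and H: at the prime `p` supplied by H, with `f` from M and the
canonical height `D` (`exists_isCanonical_holds`), PR gives `L'(W,1) = c · Ω⁺_f · ĥ(P)` and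
`[T¹] L_p · log_p γ = c · (1 - α⁻¹)² · ⟨P,P⟩_D`; `L'(W,1) ≠ 0` (`leadingLCoeff_ne_zero_holds`) forces
`c ≠ 0`, and `1 - α⁻¹ ≠ 0` (`one_sub_unitRoot_inv_ne_zero`), `⟨P,P⟩_D ≠ 0` (H) give `[T¹] L_p ≠ 0`,
i.e. `ord_T L_p ≤ 1`. -/
theorem conclusion_of_analyticRank_eq_one (hM : Statement.stub_modularity)
    (hPR : Statement.stub_perrinRiouLeadingTerms) (hH : Statement.stub_padicHeightNeZeroAtOnePrime)
    (W : WeierstrassCurve ℚ) [W.IsElliptic] [W.IsGloballyMinimal] (h1 : W.analyticRank = 1) :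
    Conclusion W := by
  obtain ⟨p, hp, h5, hgood, hord, hheight⟩ := hH W h1
  obtain ⟨N, hN, f, hf⟩ := hM W
  obtain ⟨D, hD⟩ := WeierstrassCurve.exists_isCanonical_holds W p h5 hgood hord
  obtain ⟨P, c, hP, hderiv, hcoeff⟩ := hPR W p h5 ⟨hgood, hord⟩ h1 D hD f hf
  have hlead : W.leadingLCoeff ≠ 0 := W.leadingLCoeff_ne_zero_holds hf.hasEntireLFunction
  have hderiv_ne : deriv W.entireLFunction 1 ≠ 0 := by
    have h := hlead
    rw [WeierstrassCurve.leadingLCoeff, h1, iteratedDeriv_one, Nat.factorial_one, Nat.cast_one,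
      div_one] at h
    exact h
  have hc : c ≠ 0 := by
    rintro rfl
    apply hderiv_ne
    rw [hderiv]
    simp
  have hrhs : (c : ℚ_[p]) * (1 - (unitRoot W p : ℚ_[p])⁻¹) ^ 2 * D.pairing P P ≠ 0 :=
    mul_ne_zero (mul_ne_zero (by exact_mod_cast hc)
      (pow_ne_zero _ (one_sub_unitRoot_inv_ne_zero W p ⟨hgood, hord⟩))) (hheight D hD P hP)
  have hcoeff1 : PowerSeries.coeff 1 (padicLFunction f (unitRoot W p : ℚ_[p])) ≠ 0 := by
    intro h0
    apply hrhs
    rw [← hcoeff, h0, zero_mul]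
  refine ⟨p, hp, h5, hgood, hord, N, hN, f, hf, ?_⟩
  rw [h1, Nat.cast_one]
  exact_mod_cast PowerSeries.order_le 1 hcoeff1

/-- **`PadicOrderLeAnalyticRankAtOnePrime_of`** — the four stub STATEMENTS imply the crux, BY NAME:
trichotomy `r_an = 0 ∨ r_an = 1 ∨ 2 ≤ r_an` on `W.analyticRank`, the three regimes from
`conclusion_of_analyticRank_eq_zero` (M), `conclusion_of_analyticRank_eq_one` (M, PR, H) and R2. -/
theorem PadicOrderLeAnalyticRankAtOnePrime_of (hM : Statement.stub_modularity)
    (hPR : Statement.stub_perrinRiouLeadingTerms) (hH : Statement.stub_padicHeightNeZeroAtOnePrime)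
    (hR2 : Statement.stub_twoLeAnalyticRank) : PadicOrderLeAnalyticRankAtOnePrime := by
  intro W _ _
  rcases Nat.lt_or_ge W.analyticRank 2 with hlt | hge
  · rcases Nat.le_one_iff_eq_zero_or_eq_one.mp (Nat.lt_succ_iff.mp hlt) with h0 | h1
    · exact conclusion_of_analyticRank_eq_zero hM W h0
    · exact conclusion_of_analyticRank_eq_one hM hPR hH W h1
  · exact hR2 W hge

/-- The crux along this line, MODULO the four registered stubs (sorries live only in `stub_*`). -/
theorem PadicOrderLeAnalyticRankAtOnePrime_proof : PadicOrderLeAnalyticRankAtOnePrime :=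
  PadicOrderLeAnalyticRankAtOnePrime_of stub_modularity stub_perrinRiouLeadingTerms
    stub_padicHeightNeZeroAtOnePrime stub_twoLeAnalyticRank

end Summit.BirchSwinnertonDyer.BirchSwinnertonDyer.Cruxes.PadicOrderLeAnalyticRankAtOnePrime.Birth

end
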